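import Summits.KontsevichZagierPeriods.KontsevichZagierPeriods.Theorems.BetaCancellation.Negative.IntegerExponents

/-!
# `BetaCancellation` (stmt-KontsevichZagierPeriods-13633), line `dirichlet-companion-to-pi`: stub `stub_betaWeightPinned`

If `q` is pinned over `r` with the Beta kernel `t^{a-1}(1-t)^{b-1}` (Beta variable FIRST, as in
`KZ.IntegralRep.prod`) and `s` is its weighted companion for the weight
`w(t) = t^{A+1-a}(1-t)^{B+1-b}` on `(0,1)` (extended by `0`), i.e. `s` has the domain of `q` and the
integrand `w(z₀) · q.integrand z`, then `s` is pinned over `r` with the INTEGER kernel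
`t^A (1-t)^B = aeval t (kerPoly A B)`: on the domain `0 < z₀ < 1`, so
`z₀^{A+1-a} · z₀^{a-1} = z₀^A` and `(1-z₀)^{B+1-b} · (1-z₀)^{b-1} = (1-z₀)^B`
(`Real.rpow_add`, `Real.rpow_natCast`). Pure exponent bookkeeping; no analysis.
-/

noncomputable section

set_option linter.dupNamespace false

namespace Summit.KontsevichZagierPeriods.KontsevichZagierPeriods.BetaCancellationLine

open Set
open Literature.NumberTheory.Transcendental
open Literature.NumberTheory.Transcendental.KZ
open Summit.KontsevichZagierPeriods.KontsevichZagierPeriods.BetaCancellationNegative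
  (pinDomain pinFun IsPinned kerPoly aeval_kerPoly)

/-- Exponent bookkeeping for the Beta weight: for `0 < t`, a rational `c` and `A ∈ ℕ`,
`t^{(A+1-c : ℚ)} · t^{c-1} = t^A` (`Real.rpow_add`, `Real.rpow_natCast`). [folklore] -/
theorem betaWeightPinned_rpow_mul (t : ℝ) (ht : 0 < t) (c : ℚ) (A : ℕ) :
    t ^ ((((A:ℚ) + 1 - c : ℚ)) : ℝ) * t ^ ((c:ℝ) - 1) = t ^ A := by
  have h : ((((A:ℚ) + 1 - c : ℚ)) : ℝ) + ((c:ℝ) - 1) = ((A : ℕ) : ℝ) := by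
    push_cast
    ring
  rw [← Real.rpow_add ht, h, Real.rpow_natCast]

/-- **The weighted Beta representation is pinned with an INTEGER kernel**: if `q` is pinned over
`r` with the Beta kernel `t^{a-1}(1-t)^{b-1}` and `s` is its `w_{a,b}`-weighted companion
(`w_{a,b}(t) = t^{A+1-a}(1-t)^{B+1-b}` on `(0,1)`, `0` outside; same domain, integrand
`w(z₀) · q.integrand z`), then `s` is pinned over `r` with the polynomial kernel
`t^A (1-t)^B = kerPoly A B` (`Real.rpow_add` on `t, 1 - t > 0`, `Real.rpow_natCast`). [folklore] -/
theorem stub_betaWeightPinned :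
    ∀ (a b : ℚ) (A B : ℕ) (w : ℝ → ℝ),
      (∀ t, w t = if t ∈ Set.Ioo (0:ℝ) 1 then
        t ^ ((((A:ℚ) + 1 - a : ℚ)) : ℝ) * (1 - t) ^ ((((B:ℚ) + 1 - b : ℚ)) : ℝ) else 0) →
    ∀ {n : ℕ} (r : IntegralRep n) (q s : IntegralRep (1 + n)),
      q.domain = {z | z (Fin.castAdd n 0) ∈ Set.Ioo (0:ℝ) 1 ∧ (fun j => z (Fin.natAdd 1 j)) ∈ r.domain} →
      Set.EqOn q.integrand (fun z => (z (Fin.castAdd n 0)) ^ ((a:ℝ) - 1) *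
        (1 - z (Fin.castAdd n 0)) ^ ((b:ℝ) - 1) * r.integrand (fun j => z (Fin.natAdd 1 j))) q.domain →
      s.domain = q.domain →
      (s.integrand = fun z => w (z (Fin.castAdd n 0)) * q.integrand z) →
      IsPinned (fun t => (Polynomial.aeval t (kerPoly A B) : ℝ)) r s := by
  intro a b A B w hw n r q s hqd hqi hsd hsi
  refine ⟨hsd.trans hqd, fun z hz => ?_⟩
  have hzq : z ∈ q.domain := hsd ▸ hz
  have ht : z (Fin.castAdd n 0) ∈ Set.Ioo (0:ℝ) 1 := by
    have h := hzq
    rw [hqd, Set.mem_setOf_eq] at h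
    exact h.1
  have ht0 : 0 < z (Fin.castAdd n 0) := ht.1
  have ht1 : 0 < 1 - z (Fin.castAdd n 0) := sub_pos.mpr ht.2
  have hwz := hw (z (Fin.castAdd n 0))
  rw [if_pos ht] at hwz
  simp only [hsi, pinFun, aeval_kerPoly, hqi hzq, hwz]
  rw [← betaWeightPinned_rpow_mul _ ht0 a A, ← betaWeightPinned_rpow_mul _ ht1 b B]
  ring

end Summit.KontsevichZagierPeriods.KontsevichZagierPeriods.BetaCancellationLine

end
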